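import Summits.QuantumFields.QCD.Theorems.AnomalyRigidityUniformGapTreeDecayEmptyFlavour

/-!
# Lattice QCD with NO quark flavours at `β = 0` has every uniform lattice mass gap

Route `AnomalyRigidity` (QCD sub-problem), support item ⟨stmt-QuantumFields-16260⟩
`UniformGapTreeDecay` — second route-independent half of its REFUTATION (sequel of
`AnomalyRigidityUniformGapTreeDecayEmptyFlavour.lean`, which supplies the `N_f = 0` torus functional,
the `β = 0` product Haar measure and the independence of disjoint link sets):

* two boxed observables placed at `0` and at `n e₀` on the torus of side `2S+1` read disjoint link
  sets once `n` exceeds twice the time-diameter `D` of the supports, `2D < n ≤ S`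
  (`disjoint_readEdges`: a coincidence would force `2S+1 ∣ y₀ + n − x₀` with
  `0 < |y₀ + n − x₀| < 2S+1`);
* hence their connected correlation vanishes there (`qcdLatticeConnectedCorr_eq_zero_of_far`), is
  bounded by `2 C_A C_B` everywhere (`norm_qcdLatticeConnectedCorr_le`), and every scheme with
  `N_f = 0` and `β_k ≡ 0` has `QCDScheme.HasLatticeMassGap Δ` for EVERY real `Δ`
  (`hasLatticeMassGap_zero_flavour_beta_zero`; constant `2 C_A C_B e^{|Δ|·2D}`, using only
  `a_k ≤ 1` eventually).

Def-free; no Theses import (route independent).  HONEST LABEL: ledger hygiene on a superseded,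
held support item; no crux, rung or summit is touched; neither QCD nor the Yang–Mills mass gap is
proved by this.  Seat `ym-line-fcl-p3` g20 (free hands).
-/

noncomputable section

open MeasureTheory Filter Topology ProbabilityTheory
open Literature.MathematicalPhysics.QuantumFieldTheory Literature.MathematicalPhysics.QuantumLattice

namespace Summit.QuantumFields.QCD.Theorems.UniformGapTreeDecay.EmptyFlavour

/-! ### Placements at time separation `n` read disjoint links -/

section Disjoint

/-- The time-diameter bound of a finite set of links of `ℤ⁴`: every base point has
`|x₀| ≤ timeBound`.  (Stated as an existence lemma to stay definition-free.) -/
theorem exists_time_bound (s : Finset (Literature.MathematicalPhysics.QuantumLattice.ZdEdge 4)) : ∃ D : ℕ, ∀ e ∈ s, |e.1 0| ≤ (D : ℤ) := by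
  classical
  refine ⟨s.sup fun e => (e.1 0).natAbs, fun e he => ?_⟩
  have h : (e.1 0).natAbs ≤ s.sup fun e => (e.1 0).natAbs := Finset.le_sup (f := fun e => (e.1 0).natAbs) he
  rw [← Int.natCast_natAbs]
  exact_mod_cast h

/-- **Disjointness of the read links.** If all links of `sA` and `sB` have time coordinate of
absolute value `≤ D`, then on the torus of side `2S+1` the links read by `sA` placed at `0` and by
`sB` placed at `n e₀`, `2D < n ≤ S`, are disjoint: a coincidence would force
`2S+1 ∣ (y₀ + n − x₀)` with `0 < y₀ + n − x₀ ≤ S + 2D < 2S + 1`. -/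
theorem disjoint_readEdges {sA sB : Finset (Literature.MathematicalPhysics.QuantumLattice.ZdEdge 4)} {D : ℕ} (hA : ∀ e ∈ sA, |e.1 0| ≤ (D : ℤ))
    (hB : ∀ e ∈ sB, |e.1 0| ≤ (D : ℤ)) {S n : ℕ} (hn : 2 * D < n) (hnS : n ≤ S) :
    Disjoint (sA.image fun e : Literature.MathematicalPhysics.QuantumLattice.ZdEdge 4 => torusEdge (2 * S + 1) (e.1 + 0, e.2))
      (sB.image fun e : Literature.MathematicalPhysics.QuantumLattice.ZdEdge 4 =>
        torusEdge (2 * S + 1) (e.1 + (Pi.single 0 (n : ℤ) : Literature.Probability.LatticeModels.Site 4), e.2)) := by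
  classical
  rw [Finset.disjoint_left]
  intro te htA htB
  obtain ⟨a, ha, rfl⟩ := Finset.mem_image.1 htA
  obtain ⟨b, hb, hab⟩ := Finset.mem_image.1 htB
  -- equal torus edges have equal projected base points; read off coordinate `0`
  have h0 : ((b.1 + (Pi.single 0 (n : ℤ) : Literature.Probability.LatticeModels.Site 4)) 0 : ZMod (2 * S + 1)) =
      ((a.1 + 0) 0 : ZMod (2 * S + 1)) := by
    have := congrArg (fun e : Edge 4 (2 * S + 1) => e.1 0) hab
    simpa [torusEdge, Literature.Probability.LatticeModels.Torus.proj_apply] using this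
  rw [ZMod.intCast_eq_intCast_iff_dvd_sub] at h0
  -- `h0 : (2S+1 : ℤ) ∣ a₀ - (b₀ + n)`; bound the difference
  have ha0 := hA a ha
  have hb0 := hB b hb
  simp only [Pi.add_apply, Pi.single_eq_same, Pi.zero_apply, add_zero] at h0
  obtain ⟨c, hc⟩ := h0
  have hlt : |a.1 0 - (b.1 0 + n)| < 2 * S + 1 := by
    rw [abs_lt]
    have hn' : (n : ℤ) ≤ S := by exact_mod_cast hnS
    have hD : (2 * D : ℤ) < n := by exact_mod_cast hn
    constructor <;> linarith [(abs_le.mp ha0).1, (abs_le.mp ha0).2,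
      (abs_le.mp hb0).1, (abs_le.mp hb0).2]
  have hne : a.1 0 - (b.1 0 + n) ≠ 0 := by
    intro h
    have : (n : ℤ) = a.1 0 - b.1 0 := by linarith
    have : (n : ℤ) ≤ 2 * D := by
      linarith [(abs_le.mp ha0).2, (abs_le.mp hb0).1]
    exact absurd hn (by exact_mod_cast not_lt.mpr this)
  -- a non-zero multiple of `2S+1` has absolute value `≥ 2S+1`
  have hc0 : c ≠ 0 := by
    rintro rfl
    rw [mul_zero] at hc
    exact hne hc
  have hge : (2 * S + 1 : ℤ) ≤ |a.1 0 - (b.1 0 + n)| := by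
    rw [hc, abs_mul]
    have h1 : (1 : ℤ) ≤ |c| := Int.one_le_abs hc0
    have h2 : |((2 * S + 1 : ℕ) : ℤ)| = 2 * S + 1 := by push_cast; exact abs_of_nonneg (by positivity)
    rw [h2]
    nlinarith
  exact absurd hlt (not_lt.mpr hge)

end Disjoint

/-! ### The uniform lattice mass gap with no flavours at `β = 0` -/

section Gap

/-- **Connected correlations vanish beyond the supports** (no flavours, `β = 0`): for boxed
observables `A, B` whose support links have time coordinates of absolute value `≤ D`, on the
torus of side `2S+1`, the connected correlation at time separation `n`, `2D < n ≤ S`, is `0` — the two placements are functions of disjoint, hence independent, link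
sets of the product Haar measure. -/
theorem qcdLatticeConnectedCorr_eq_zero_of_far {R R' : ℕ} (A : QCDLatticeObservable 0 R)
    (B : QCDLatticeObservable 0 R') {D : ℕ} (hA : ∀ e ∈ A.supp, |e.1 0| ≤ (D : ℤ))
    (hB : ∀ e ∈ B.supp, |e.1 0| ≤ (D : ℤ)) (mq : Fin 0 → ℝ) {S n : ℕ} (hn : 2 * D < n)
    (hnS : n ≤ S) :
    qcdLatticeConnectedCorr 0 (2 * S + 1) mq A B n = 0 := by
  classical
  haveI : IsProbabilityMeasure (haarProbability (Matrix.specialUnitaryGroup (Fin 3) ℂ)) := inferInstance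
  haveI := isEmpty_fermiIdx_sum_zero (2 * S + 1)
  unfold qcdLatticeConnectedCorr
  rw [qcdTorusExpect_zero_flavour, qcdTorusExpect_zero_flavour, qcdTorusExpect_zero_flavour,
    wilsonMeasure_beta_zero, sub_eq_zero]
  have hmul : ∀ U : GaugeConfig 4 (2 * S + 1) (Matrix.specialUnitaryGroup (Fin 3) ℂ),
      fermiIntegral (A.onTorus (2 * S + 1) 0 U * B.onTorus (2 * S + 1) (Pi.single 0 (n : ℤ)) U) =
        fermiIntegral (A.onTorus (2 * S + 1) 0 U) *
          fermiIntegral (B.onTorus (2 * S + 1) (Pi.single 0 (n : ℤ)) U) := fun U => berezin_mul _ _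
  simp only [hmul]
  have hdA := dependsOn_fermiIntegral_onTorus A (2 * S + 1) 0
  have hdB := dependsOn_fermiIntegral_onTorus B (2 * S + 1) (Pi.single 0 (n : ℤ))
  exact integral_mul_eq_of_dependsOn_disjoint_pi (haarProbability (Matrix.specialUnitaryGroup (Fin 3) ℂ)) (disjoint_readEdges hA hB hn hnS)
    (measurable_fermiIntegral_onTorus A _ _) (measurable_fermiIntegral_onTorus B _ _) hdA hdB

/-- **Connected correlations are uniformly bounded** (no flavours): by twice the product of the
bounds of the two Berezin scalars, on every torus, at every placement and separation. -/
theorem norm_qcdLatticeConnectedCorr_le {R R' : ℕ} (A : QCDLatticeObservable 0 R)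
    (B : QCDLatticeObservable 0 R') {CA CB : ℝ} (hCA : 0 ≤ CA)
    (hA : ∀ (S : ℕ) [NeZero S] (v : Literature.Probability.LatticeModels.Site 4) (U : GaugeConfig 4 S (Matrix.specialUnitaryGroup (Fin 3) ℂ)),
      ‖fermiIntegral (A.onTorus S v U)‖ ≤ CA)
    (hB : ∀ (S : ℕ) [NeZero S] (v : Literature.Probability.LatticeModels.Site 4) (U : GaugeConfig 4 S (Matrix.specialUnitaryGroup (Fin 3) ℂ)),
      ‖fermiIntegral (B.onTorus S v U)‖ ≤ CB)
    (β : ℝ) (mq : Fin 0 → ℝ) (S : ℕ) [NeZero S] (n : ℕ) :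
    ‖qcdLatticeConnectedCorr β S mq A B n‖ ≤ 2 * (CA * CB) := by
  haveI : IsProbabilityMeasure (wilsonMeasure (d := 4) (L := S) (fundamentalRep (Fin 3)) β) :=
    isProbabilityMeasure_wilsonMeasure _ (continuous_fundamentalRep _) β
  haveI := isEmpty_fermiIdx_sum_zero S
  unfold qcdLatticeConnectedCorr
  rw [qcdTorusExpect_zero_flavour, qcdTorusExpect_zero_flavour, qcdTorusExpect_zero_flavour]
  have h1 : ‖∫ U, fermiIntegral (A.onTorus S 0 U * B.onTorus S (Pi.single 0 (n : ℤ)) U)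
      ∂(wilsonMeasure (d := 4) (L := S) (fundamentalRep (Fin 3)) β)‖ ≤ CA * CB := by
    refine (norm_integral_le_of_norm_le_const (Eventually.of_forall fun U => ?_)).trans_eq
      (by rw [probReal_univ, mul_one])
    rw [show fermiIntegral (A.onTorus S 0 U * B.onTorus S (Pi.single 0 (n : ℤ)) U) =
        fermiIntegral (A.onTorus S 0 U) * fermiIntegral (B.onTorus S (Pi.single 0 (n : ℤ)) U) from
      berezin_mul _ _, norm_mul]
    exact mul_le_mul (hA S 0 U) (hB S _ U) (norm_nonneg _) hCA
  have h2 : ‖∫ U, fermiIntegral (A.onTorus S 0 U)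
      ∂(wilsonMeasure (d := 4) (L := S) (fundamentalRep (Fin 3)) β)‖ ≤ CA :=
    (norm_integral_le_of_norm_le_const (Eventually.of_forall fun U => hA S 0 U)).trans_eq
      (by rw [probReal_univ, mul_one])
  have h3 : ‖∫ U, fermiIntegral (B.onTorus S (Pi.single 0 (n : ℤ)) U)
      ∂(wilsonMeasure (d := 4) (L := S) (fundamentalRep (Fin 3)) β)‖ ≤ CB :=
    (norm_integral_le_of_norm_le_const (Eventually.of_forall fun U => hB S _ U)).trans_eq
      (by rw [probReal_univ, mul_one])
  calc ‖(∫ U, fermiIntegral (A.onTorus S 0 U * B.onTorus S (Pi.single 0 (n : ℤ)) U)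
          ∂(wilsonMeasure (d := 4) (L := S) (fundamentalRep (Fin 3)) β)) -
        (∫ U, fermiIntegral (A.onTorus S 0 U) ∂(wilsonMeasure (d := 4) (L := S) (fundamentalRep (Fin 3)) β)) *
          ∫ U, fermiIntegral (B.onTorus S (Pi.single 0 (n : ℤ)) U)
            ∂(wilsonMeasure (d := 4) (L := S) (fundamentalRep (Fin 3)) β)‖
      ≤ CA * CB + CA * CB := by
        refine (norm_sub_le _ _).trans (add_le_add h1 ?_)
        rw [norm_mul]
        exact mul_le_mul h2 h3 (norm_nonneg _) hCA
    _ = 2 * (CA * CB) := by ring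

/-- **Every scheme with no flavours and `β_k ≡ 0` has the uniform lattice mass gap for every rate
`Δ`**: beyond twice the time-diameter of the two supports the connected correlation vanishes, and
the finitely many short separations are absorbed in the constant (`a_k → 0` keeps
`e^{-Δ a_k n} ≥ e^{-|Δ|(2D)}` there). -/
theorem hasLatticeMassGap_zero_flavour_beta_zero (sch : QCDScheme 0) (hβ : ∀ k, sch.β k = 0) (Δ : ℝ) :
    sch.HasLatticeMassGap Δ := by
  intro R R' A B
  obtain ⟨DA, hDA⟩ := exists_time_bound A.supp
  obtain ⟨DB, hDB⟩ := exists_time_bound B.supp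
  set D : ℕ := max DA DB with hD
  have hA : ∀ e ∈ A.supp, |e.1 0| ≤ (D : ℤ) := fun e he =>
    (hDA e he).trans (by exact_mod_cast le_max_left DA DB)
  have hB : ∀ e ∈ B.supp, |e.1 0| ≤ (D : ℤ) := fun e he =>
    (hDB e he).trans (by exact_mod_cast le_max_right DA DB)
  obtain ⟨CA, hCA0, hCA⟩ := exists_bound_fermiIntegral_onTorus A
  obtain ⟨CB, hCB0, hCB⟩ := exists_bound_fermiIntegral_onTorus B
  -- the constant: short separations `n ≤ 2D` with `a_k ≤ 1`
  refine ⟨2 * (CA * CB) * Real.exp (|Δ| * (2 * D)), ?_⟩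
  -- eventually `a_k ≤ 1`
  have ha : ∀ᶠ k in atTop, sch.a k ≤ 1 := by
    have := sch.tendsto_a
    exact (this.eventually (ge_mem_nhds one_pos)).mono fun k hk => hk
  have hC : 0 ≤ 2 * (CA * CB) * Real.exp (|Δ| * (2 * D)) :=
    mul_nonneg (mul_nonneg zero_le_two (mul_nonneg hCA0 hCB0)) (Real.exp_pos _).le
  filter_upwards [ha] with k hak S _hSL n hnS
  by_cases hn : 2 * D < n
  · -- far: the connected correlation vanishes
    rw [hβ k, qcdLatticeConnectedCorr_eq_zero_of_far A B hA hB _ hn hnS, norm_zero]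
    exact mul_nonneg hC (Real.exp_pos _).le
  · -- near: bounded numerator, bounded-below exponential
    replace hn : n ≤ 2 * D := not_lt.mp hn
    have hcorr := norm_qcdLatticeConnectedCorr_le A B hCA0 hCA hCB (sch.β k)
      (fun fl => sch.mq fl k) (2 * S + 1) n
    have hexp : Real.exp (-(|Δ| * (2 * D))) ≤ Real.exp (-(Δ * (sch.a k * n))) := by
      apply Real.exp_le_exp.mpr
      have h1 : Δ * (sch.a k * n) ≤ |Δ| * (sch.a k * n) :=
        mul_le_mul_of_nonneg_right (le_abs_self Δ) (mul_nonneg (sch.a_pos k).le (Nat.cast_nonneg _))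
      have h2 : |Δ| * (sch.a k * n) ≤ |Δ| * (2 * D) := by
        apply mul_le_mul_of_nonneg_left _ (abs_nonneg Δ)
        calc sch.a k * n ≤ 1 * n := by gcongr
          _ = n := one_mul _
          _ ≤ 2 * D := by exact_mod_cast hn
      linarith
    calc ‖qcdLatticeConnectedCorr (sch.β k) (2 * S + 1) (fun fl => sch.mq fl k) A B n‖
        ≤ 2 * (CA * CB) := hcorr
      _ = 2 * (CA * CB) * Real.exp (|Δ| * (2 * D)) * Real.exp (-(|Δ| * (2 * D))) := by
          rw [mul_assoc (2 * (CA * CB)), ← Real.exp_add, add_neg_cancel, Real.exp_zero, mul_one]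
      _ ≤ 2 * (CA * CB) * Real.exp (|Δ| * (2 * D)) * Real.exp (-(Δ * (sch.a k * n))) := by
          gcongr

end Gap

end Summit.QuantumFields.QCD.Theorems.UniformGapTreeDecay.EmptyFlavour

end
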